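import Summits.KontsevichZagierPeriods.Zeta5Search.WedgeDictionaryQuadratic
import HarnessLib

/-!
# ζ(5) search — partial-fraction data under multiplication by linear factors (cell `pub-zeta5`, TYPER)

HONEST FRAMING: systematic search; no irrationality claim unless certified.

OUR tool (Summit side), extending the tree's Ball–Rivoal brick calculus
(`Literature.NumberTheory.Transcendental.BallRivoal.{pfEval, IsInt, exists_pf_prod, pf_unique}`): there a
product of PROPER bricks `P(t)/(t+1)_{n+1}` (`deg P ≤ n`) gets partial-fraction data with controlled
denominators. Very-well-poised summands also carry POLYNOMIAL factors that do not fit into a proper brick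
(e.g. Brown–Zudilin's dual series `F̃₇(b)` on the record ray: `DESIGN-F7-denominators.md` of the cell). This
file multiplies partial-fraction data by integer linear factors `αt + β` one at a time, keeping track of
the polynomial part that appears, and shows that the denominators do not get worse:

* `trunc K c` — data cut off at order `K` (same `pfEval`, same `IsInt`);
* `linStep n K α β c` — the data of `(αt+β)·Σ c_{o,p}/(t+p+1)^{o+1}` minus its constant part:
  `pfEval (linStep …) t = (αt+β)·pfEval c t − α Σ_p c_{0,p}` (`pfEval_linStep`), and
  `IsInt K d c → IsInt K d (linStep …)` (`isInt_linStep`);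
* `linSteps` — iteration over a list of factors, with the polynomial part `polyPart` (a `ℚ[X]`):
  `pfEval (linSteps L c) t + (polyPart L c).eval t = (∏_{(α,β)∈L} (αt+β)) · pfEval c t` and `IsInt` preserved;
* `poly_eq_zero_of_pfEval_eq` — if `pfEval n K c k = Q(k)` at all large naturals `k` then `Q = 0`
  (so the polynomial part of a PROPER product vanishes and `pf_unique` applies; uses typer g3's
  `WedgeDictionary.pfEval_tendsto_zero`);
* `subBlock_eq_brickEval` — the reciprocal brick on a sub-block, `(L-1)!/(t+a+1)_L = Σ_p A_p/(t+p+1)` with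
  `A_p = (-1)^{p-a} C(L-1, p-a)` on `a ≤ p < a+L` (else `0`), as a `BallRivoal.brickEval n` (`a + L ≤ n + 1`).

Everything is PROVED (0 sorry).
-/

noncomputable section

open Finset Filter Topology Polynomial
open Literature.NumberTheory.Transcendental
open Literature.NumberTheory.Transcendental.BallRivoal

namespace Summit.KontsevichZagierPeriods.Zeta5Search

namespace PFSteps

variable {n K d : ℕ}

/-! ### Truncation -/

/-- Cut data off at order `K` (orders `≥ K` are never evaluated by `pfEval n K`). -/
def trunc (K : ℕ) (c : ℕ → ℕ → ℚ) : ℕ → ℕ → ℚ := fun o p => if o < K then c o p else 0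

/-- `pfEval` ignores orders `≥ K`. -/
theorem pfEval_trunc (n K : ℕ) (c : ℕ → ℕ → ℚ) (t : ℚ) : pfEval n K (trunc K c) t = pfEval n K c t := by
  unfold pfEval trunc
  refine sum_congr rfl fun p _ => sum_congr rfl fun o ho => ?_
  rw [if_pos (mem_range.1 ho)]

/-- `IsInt` is preserved by truncation. -/
theorem isInt_trunc {c : ℕ → ℕ → ℚ} (h : IsInt K d c) : IsInt K d (trunc K c) := by
  intro o p
  unfold trunc
  by_cases ho : o < K
  · rw [if_pos ho]; exact h o p
  · exact ⟨0, by rw [if_neg ho]; simp⟩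

/-- Truncated data vanish at orders `≥ K`. -/
theorem trunc_of_le {c : ℕ → ℕ → ℚ} {o : ℕ} (ho : K ≤ o) (p : ℕ) : trunc K c o p = 0 := by
  unfold trunc; rw [if_neg (not_lt.2 ho)]

/-! ### One linear factor -/

/-- The data of `(αt+β) · Σ_{o<K} c_{o,p}/(t+p+1)^{o+1}` (minus its constant part `α c_{0,p}`):
`c'_{o,p} = α c_{o+1,p} + (β − α(p+1)) c_{o,p}` (for data supported in orders `< K`). -/
def linStep (α β : ℤ) (c : ℕ → ℕ → ℚ) : ℕ → ℕ → ℚ :=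
  fun o p => (α : ℚ) * c (o + 1) p + ((β : ℚ) - α * ((p : ℚ) + 1)) * c o p

/-- The one-pole identity behind `pfEval_linStep`. -/
theorem inner_linStep (K : ℕ) (f : ℕ → ℚ) (hf : ∀ o, K ≤ o → f o = 0) (u α γ : ℚ) (hu : u ≠ 0) :
    ∑ o ∈ range K, (α * f (o + 1) + γ * f o) / u ^ (o + 1)
      = (α * u + γ) * ∑ o ∈ range K, f o / u ^ (o + 1) - α * f 0 := by
  have h1 : ∑ o ∈ range K, α * f (o + 1) / u ^ (o + 1) = ∑ o ∈ range K, α * f o / u ^ o - α * f 0 := by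
    have e : ∑ o ∈ range (K + 1), α * f o / u ^ o = ∑ o ∈ range K, α * f (o + 1) / u ^ (o + 1) + α * f 0 / u ^ 0 :=
      sum_range_succ' _ _
    rw [sum_range_succ, hf K le_rfl, mul_zero, zero_div, add_zero, pow_zero, div_one] at e
    linarith
  have h2 : (α * u) * ∑ o ∈ range K, f o / u ^ (o + 1) = ∑ o ∈ range K, α * f o / u ^ o := by
    rw [mul_sum]
    refine sum_congr rfl fun o _ => ?_
    rw [pow_succ]
    field_simp
  calc ∑ o ∈ range K, (α * f (o + 1) + γ * f o) / u ^ (o + 1)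
      = ∑ o ∈ range K, α * f (o + 1) / u ^ (o + 1) + ∑ o ∈ range K, γ * f o / u ^ (o + 1) := by
        rw [← sum_add_distrib]; exact sum_congr rfl fun o _ => by ring
    _ = (∑ o ∈ range K, α * f o / u ^ o - α * f 0) + γ * ∑ o ∈ range K, f o / u ^ (o + 1) := by
        rw [h1, mul_sum]
        congr 1
        exact sum_congr rfl fun o _ => by ring
    _ = _ := by rw [← h2]; ring

/-- **`pfEval (linStep α β c) t = (αt+β) pfEval c t − α Σ_p c_{0,p}`** for data supported in orders `< K`
and `t` away from the poles. -/
theorem pfEval_linStep (n K : ℕ) (α β : ℤ) (c : ℕ → ℕ → ℚ) (hc : ∀ o p, K ≤ o → c o p = 0)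
    (t : ℚ) (ht : ∀ p, p ≤ n → t + p + 1 ≠ 0) :
    pfEval n K (linStep α β c) t
      = ((α : ℚ) * t + β) * pfEval n K c t - α * ∑ p ∈ range (n + 1), c 0 p := by
  unfold pfEval linStep
  rw [mul_sum, mul_sum, ← sum_sub_distrib]
  refine sum_congr rfl fun p hp => ?_
  have hu := ht p (Nat.lt_succ_iff.1 (mem_range.1 hp))
  have h := inner_linStep K (fun o => c o p) (fun o ho => hc o p ho) (t + p + 1) α
    ((β : ℚ) - α * ((p : ℚ) + 1)) hu
  rw [h]
  ring

/-- `linStep` keeps the support in orders `< K`. -/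
theorem linStep_of_le (α β : ℤ) {c : ℕ → ℕ → ℚ} (hc : ∀ o p, K ≤ o → c o p = 0) :
    ∀ o p, K ≤ o → linStep α β c o p = 0 := by
  intro o p ho
  unfold linStep
  rw [hc o p ho, hc (o + 1) p (by omega), mul_zero, mul_zero, add_zero]

/-- **`IsInt` is preserved by a linear step** (integer `α, β`; data supported in orders `< K`):
`d^{K-1-o} c'_{o,p} = α·d·(d^{K-1-(o+1)} c_{o+1,p}) + (β − α(p+1))·(d^{K-1-o} c_{o,p})`. -/
theorem isInt_linStep (α β : ℤ) {c : ℕ → ℕ → ℚ} (hc : ∀ o p, K ≤ o → c o p = 0)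
    (h : IsInt K d c) : IsInt K d (linStep α β c) := by
  intro o p
  obtain ⟨z0, hz0⟩ := h o p
  by_cases ho : o + 1 < K
  · obtain ⟨z1, hz1⟩ := h (o + 1) p
    refine ⟨α * d * z1 + (β - α * (p + 1)) * z0, ?_⟩
    have e : K - 1 - o = (K - 1 - (o + 1)) + 1 := by omega
    unfold linStep
    push_cast
    rw [← hz0, ← hz1, e, pow_succ]
    ring
  · refine ⟨(β - α * (p + 1)) * z0, ?_⟩
    unfold linStep
    rw [hc (o + 1) p (by omega)]
    push_cast
    rw [← hz0]
    ring

/-! ### A list of linear factors, with the polynomial part -/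

/-- Iterated linear steps (the head of the list is applied LAST). -/
def linSteps : List (ℤ × ℤ) → (ℕ → ℕ → ℚ) → ℕ → ℕ → ℚ
  | [], c => c
  | (α, β) :: L, c => linStep α β (linSteps L c)

/-- The polynomial part accumulated by `linSteps`:
`Q_{(α,β)::L} = (αX+β)·Q_L + α·Σ_p (linSteps L c)_{0,p}`. -/
def polyPart (n : ℕ) : List (ℤ × ℤ) → (ℕ → ℕ → ℚ) → ℚ[X]
  | [], _ => 0
  | (α, β) :: L, c => (C (α : ℚ) * X + C (β : ℚ)) * polyPart n L c
      + C ((α : ℚ) * ∑ p ∈ range (n + 1), linSteps L c 0 p)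

/-- The product of the linear factors of a list. -/
def linProd (L : List (ℤ × ℤ)) (t : ℚ) : ℚ := (L.map fun ab : ℤ × ℤ => (ab.1 : ℚ) * t + ab.2).prod

/-- `linSteps` keeps the support in orders `< K`. -/
theorem linSteps_of_le {c : ℕ → ℕ → ℚ} (hc : ∀ o p, K ≤ o → c o p = 0) :
    ∀ (L : List (ℤ × ℤ)) (o p : ℕ), K ≤ o → linSteps L c o p = 0
  | [], o, p, ho => hc o p ho
  | (α, β) :: L, o, p, ho => linStep_of_le α β (fun o p ho => linSteps_of_le hc L o p ho) o p ho

/-- **`IsInt` is preserved by any number of integer linear steps.** -/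
theorem isInt_linSteps {c : ℕ → ℕ → ℚ} (hc : ∀ o p, K ≤ o → c o p = 0) (h : IsInt K d c) :
    ∀ L : List (ℤ × ℤ), IsInt K d (linSteps L c)
  | [] => h
  | (α, β) :: L => isInt_linStep α β (fun o p ho => linSteps_of_le hc L o p ho) (isInt_linSteps hc h L)

/-- **Evaluation of iterated linear steps**:
`pfEval (linSteps L c) t + Q_L(t) = (∏ (αt+β)) · pfEval c t` away from the poles. -/
theorem pfEval_linSteps (n K : ℕ) {c : ℕ → ℕ → ℚ} (hc : ∀ o p, K ≤ o → c o p = 0)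
    (t : ℚ) (ht : ∀ p, p ≤ n → t + p + 1 ≠ 0) :
    ∀ L : List (ℤ × ℤ),
      pfEval n K (linSteps L c) t + (polyPart n L c).eval t = linProd L t * pfEval n K c t
  | [] => by simp [linSteps, polyPart, linProd]
  | (α, β) :: L => by
    have ih := pfEval_linSteps n K hc t ht L
    rw [linSteps, polyPart, pfEval_linStep n K α β _ (fun o p ho => linSteps_of_le hc L o p ho) t ht,
      eval_add, eval_mul, eval_add, eval_mul, eval_C, eval_X, eval_C, eval_C, linProd, List.map_cons,
      List.prod_cons, ← linProd]
    linear_combination ((α : ℚ) * t + β) * ih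

/-! ### A polynomial that is a partial-fraction sum at all large naturals is zero -/

/-- A real polynomial whose values at the naturals tend to `0` is zero. [folklore] -/
theorem poly_eq_zero_of_tendsto_natCast (P : ℝ[X])
    (h : Tendsto (fun k : ℕ => P.eval (k : ℝ)) atTop (𝓝 0)) : P = 0 := by
  by_contra hP
  have hequiv := (P.isEquivalent_atTop_lead).comp_tendsto tendsto_natCast_atTop_atTop
  have hlead : Tendsto (fun k : ℕ => P.leadingCoeff * (k : ℝ) ^ P.natDegree) atTop (𝓝 0) :=
    (hequiv.tendsto_nhds_iff).1 h
  have hlc : P.leadingCoeff ≠ 0 := leadingCoeff_ne_zero.2 hP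
  by_cases hD : P.natDegree = 0
  · rw [hD] at hlead
    simp only [pow_zero, mul_one, tendsto_const_nhds_iff] at hlead
    exact hlc hlead
  · have hpow : Tendsto (fun k : ℕ => (k : ℝ) ^ P.natDegree) atTop atTop :=
      (tendsto_pow_atTop hD).comp tendsto_natCast_atTop_atTop
    have h0 : Tendsto (fun k : ℕ => (k : ℝ) ^ P.natDegree) atTop (𝓝 0) := by
      have := hlead.const_mul (P.leadingCoeff⁻¹)
      rw [mul_zero] at this
      refine this.congr fun k => ?_
      field_simp
    exact not_tendsto_nhds_of_tendsto_atTop hpow 0 h0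

/-- **If `pfEval n K c k = Q(k)` for all naturals `k ≥ T` then `Q = 0`.** -/
theorem poly_eq_zero_of_pfEval_eq (n K : ℕ) (c : ℕ → ℕ → ℚ) (Q : ℚ[X]) (T : ℕ)
    (h : ∀ k : ℕ, T ≤ k → pfEval n K c k = Q.eval (k : ℚ)) : Q = 0 := by
  set QR : ℝ[X] := Q.map (algebraMap ℚ ℝ) with hQR
  have hev : ∀ k : ℕ, ((Q.eval (k : ℚ) : ℚ) : ℝ) = QR.eval (k : ℝ) := by
    intro k
    rw [hQR, eval_map, show ((k : ℕ) : ℝ) = algebraMap ℚ ℝ (k : ℚ) by simp, eval₂_hom]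
    exact (eq_ratCast (algebraMap ℚ ℝ) _).symm
  have hlim : Tendsto (fun k : ℕ => QR.eval (k : ℝ)) atTop (𝓝 0) := by
    refine (WedgeDictionary.pfEval_tendsto_zero n K c).congr' ?_
    filter_upwards [eventually_ge_atTop T] with k hk
    rw [h k hk, hev]
  have hQR0 : QR = 0 := poly_eq_zero_of_tendsto_natCast QR hlim
  rw [hQR] at hQR0
  exact (Polynomial.map_eq_zero_iff (algebraMap ℚ ℝ).injective).1 hQR0

/-- **Uniqueness with a polynomial part**: if `pfEval n K c k + Q(k) = 0` at all naturals `k ≥ T`, then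
`Q = 0` and `c = 0` on the support. -/
theorem pf_unique_poly (n K : ℕ) (c : ℕ → ℕ → ℚ) (Q : ℚ[X]) (T : ℕ)
    (h : ∀ k : ℕ, T ≤ k → pfEval n K c k + Q.eval (k : ℚ) = 0) :
    Q = 0 ∧ ∀ o p, o < K → p ≤ n → c o p = 0 := by
  have hQ : Q = 0 := by
    have := poly_eq_zero_of_pfEval_eq n K c (-Q) T (fun k hk => by rw [eval_neg]; linarith [h k hk])
    rwa [neg_eq_zero] at this
  refine ⟨hQ, pf_unique n K c T fun k hk => ?_⟩
  have := h k hk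
  rwa [hQ, eval_zero, add_zero] at this

/-! ### The reciprocal brick on a sub-block -/

/-- Residues of the sub-block brick `(L-1)!/(t+a+1)_L` inside the block `(t+1)_{n+1}`:
`(-1)^{p-a} C(L-1, p-a)` for `a ≤ p < a + L`, else `0`. -/
def subRes (a L : ℕ) (p : ℕ) : ℤ :=
  if a ≤ p ∧ p < a + L then (-1) ^ (p - a) * ((L - 1).choose (p - a) : ℤ) else 0

/-- **The sub-block brick**: `(L-1)!/(t+a+1)_L = Σ_{p≤n} subRes a L p/(t+p+1)` for `1 ≤ L`, `a + L ≤ n + 1`. -/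
theorem subBlock_eq_brickEval (n a L : ℕ) (hL : 1 ≤ L) (haL : a + L ≤ n + 1) (t : ℚ)
    (ht : ∀ p, p ≤ n → t + p + 1 ≠ 0) :
    (((L - 1).factorial : ℕ) : ℚ) / poch (t + a + 1) L = brickEval n (subRes a L) t := by
  obtain ⟨L', rfl⟩ : ∃ L', L = L' + 1 := ⟨L - 1, by omega⟩
  have ht' : ∀ m, m ≤ L' → (t + a) + m + 1 ≠ 0 := fun m hm h => ht (a + m) (by omega) (by push_cast; linarith)
  have hH := H_eq_brickEval L' (t + a) ht'
  rw [show L' + 1 - 1 = L' by omega, show t + a + 1 = (t + a) + 1 by ring, hH, brickEval, brickEval]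
  -- restrict the big sum to the image of `range (L'+1)` under `a + ·`
  symm
  rw [← sum_subset (s₁ := (range (L' + 1)).image (fun m => a + m))]
  · rw [sum_image (fun x _ y _ h => by simpa using h)]
    refine sum_congr rfl fun m hm => ?_
    have hm' := mem_range.1 hm
    rw [subRes, if_pos ⟨by omega, by omega⟩, show a + m - a = m by omega, resH, show L' + 1 - 1 = L' by omega]
    push_cast
    ring
  · intro p hp
    rw [mem_image] at hp
    obtain ⟨m, hm, rfl⟩ := hp
    exact mem_range.2 (by have := mem_range.1 hm; omega)
  · intro p _ hp
    have hp' : ¬ (a ≤ p ∧ p < a + (L' + 1)) := by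
      intro hc
      exact hp (mem_image.2 ⟨p - a, mem_range.2 (by omega), by omega⟩)
    rw [subRes, if_neg hp']
    simp

end PFSteps

end Summit.KontsevichZagierPeriods.Zeta5Search
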